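import Summits.KontsevichZagierPeriods.KontsevichZagierPeriods.Theses.IsogenyCertificates
import Summits.KontsevichZagierPeriods.KontsevichZagierPeriods.Theorems.IsogenyCertificatesXMapPeriodTransferCellsBasic

/-!
# `XMapPeriodTransfer` (stmt-KontsevichZagierPeriods-10665), line `saturated-sign-cells` — stub `stub_intervalImage`

Pure real analysis used by the line `saturated-sign-cells` of the crux
`IsogenyCertificates.XMapPeriodTransfer` (Cruxes/XMapPeriodTransfer/Lines/saturated_sign_cells.lean):
a continuous strictly monotone (or antitone) function `φ` on an open interval `C = (p, ∞)` or
`C = (p, q)`, with values in `{P' > 0}` (`P'(y) = y³ + A'y + B'`) and whose one-sided end limits are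
each either a root of `P'` or infinite in absolute value, maps `C` onto `(u, ∞)` or onto `(u, v)`
with `u < v` roots of `P'`. The end towards which `φ` decreases must have a finite limit because
`{P' > 0}` is bounded below; the image is order-connected (a continuous image of an interval), does
not contain its end values (strictness) and approaches them (the limits).

The core is the filter-level lemma `intervalImage_core` (two abstract "end filters" approaching the
infimum and the supremum side of an order-connected set); `stub_intervalImage` instantiates it in the
four cases increasing/decreasing × bounded/unbounded cell.

References: M. Kontsevich, D. Zagier, *Periods* (2001), §1.2 (the rule-(2) pieces this serves).
-/

noncomputable section

open Set Filter Topology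

namespace Summit.KontsevichZagierPeriods.IsogenyCertificates.XMapPeriodTransferCells

/-- `{P' > 0}` is bounded below by `-(1 + |A'| + |B'|)`. [folklore] -/
theorem intervalImage_lower_bound (A' B' : ℤ) {y : ℝ} (hy : 0 < y ^ 3 + (A' : ℝ) * y + (B' : ℝ)) :
    -(1 + |(A' : ℝ)| + |(B' : ℝ)|) < y := by
  by_contra h
  have hz : 1 + |(A' : ℝ)| + |((-B' : ℤ) : ℝ)| ≤ -y := by
    push_cast
    rw [abs_neg]
    linarith [not_lt.1 h]
  have hpos := cubic_pos_of_large_le A' (-B') hz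
  push_cast at hpos
  nlinarith

/-- **Core of the interval-image lemma.** Let `I ⊆ (m, ∞)` be order-connected and non-empty, and let
`F₁`, `F₂` be non-trivial filters along which `g` takes values in `I` below, resp. above, any given
point of `I`. If along each of them `g` tends to a root of `P'` or `|g| → ∞`, then
`I = (u, ∞)` or `I = (u, v)` with `u < v` roots of `P'`. [folklore] -/
theorem intervalImage_core (A' B' : ℤ) (g : ℝ → ℝ) (I : Set ℝ) (m : ℝ) (F₁ F₂ : Filter ℝ)
    [F₁.NeBot] [F₂.NeBot] (hI : I.OrdConnected) (hne : I.Nonempty) (hIm : I ⊆ Ioi m)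
    (hlo : ∀ y ∈ I, ∀ᶠ t in F₁, g t ∈ I ∧ g t < y)
    (hhi : ∀ y ∈ I, ∀ᶠ t in F₂, g t ∈ I ∧ y < g t)
    (hlim₁ : (∃ ℓ : ℝ, ℓ ^ 3 + (A' : ℝ) * ℓ + (B' : ℝ) = 0 ∧ Tendsto g F₁ (𝓝 ℓ)) ∨
      Tendsto (fun x => |g x|) F₁ atTop)
    (hlim₂ : (∃ ℓ : ℝ, ℓ ^ 3 + (A' : ℝ) * ℓ + (B' : ℝ) = 0 ∧ Tendsto g F₂ (𝓝 ℓ)) ∨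
      Tendsto (fun x => |g x|) F₂ atTop) :
    ∃ u : ℝ, u ^ 3 + (A' : ℝ) * u + (B' : ℝ) = 0 ∧
      (I = Ioi u ∨ ∃ v : ℝ, v ^ 3 + (A' : ℝ) * v + (B' : ℝ) = 0 ∧ u < v ∧ I = Ioo u v) := by
  obtain ⟨y₀, hy₀⟩ := hne
  -- the infimum side has a finite limit (the image is bounded below)
  have hfin : ∃ u : ℝ, u ^ 3 + (A' : ℝ) * u + (B' : ℝ) = 0 ∧ Tendsto g F₁ (𝓝 u) := by
    rcases hlim₁ with h | h
    · exact h
    · exfalso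
      obtain ⟨t, ⟨htI, hty⟩, hgt⟩ := ((hlo y₀ hy₀).and (h.eventually_gt_atTop (max |m| |y₀|))).exists
      have hm : m < g t := hIm htI
      have : |g t| ≤ max |m| |y₀| := abs_le_max_abs_abs hm.le hty.le
      linarith
  obtain ⟨u, hu, hu_t⟩ := hfin
  have hle : ∀ y ∈ I, u ≤ y := fun y hy =>
    le_of_tendsto hu_t ((hlo y hy).mono fun t ht => ht.2.le)
  have hlt : ∀ y ∈ I, u < y := fun y hy => by
    obtain ⟨t, htI, hty⟩ := (hlo y hy).exists
    exact (hle _ htI).trans_lt hty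
  have hbelow : ∀ z, u < z → ∃ a ∈ I, a < z := fun z hz => by
    have h1 : ∀ᶠ t in F₁, g t < z := hu_t (Iio_mem_nhds hz)
    obtain ⟨t, ⟨htI, -⟩, htz⟩ := ((hlo y₀ hy₀).and h1).exists
    exact ⟨g t, htI, htz⟩
  refine ⟨u, hu, ?_⟩
  rcases hlim₂ with ⟨v, hv, hv_t⟩ | htop
  · right
    have hge : ∀ y ∈ I, y ≤ v := fun y hy =>
      ge_of_tendsto hv_t ((hhi y hy).mono fun t ht => ht.2.le)
    have hgt : ∀ y ∈ I, y < v := fun y hy => by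
      obtain ⟨t, htI, hty⟩ := (hhi y hy).exists
      exact hty.trans_le (hge _ htI)
    have habove : ∀ z, z < v → ∃ b ∈ I, z < b := fun z hz => by
      have h1 : ∀ᶠ t in F₂, z < g t := hv_t (Ioi_mem_nhds hz)
      obtain ⟨t, ⟨htI, -⟩, htz⟩ := ((hhi y₀ hy₀).and h1).exists
      exact ⟨g t, htI, htz⟩
    refine ⟨v, hv, (hlt y₀ hy₀).trans (hgt y₀ hy₀), ?_⟩
    ext z
    constructor
    · intro hz
      exact ⟨hlt z hz, hgt z hz⟩
    · rintro ⟨h1, h2⟩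
      obtain ⟨a, haI, haz⟩ := hbelow z h1
      obtain ⟨b, hbI, hzb⟩ := habove z h2
      exact hI.out haI hbI ⟨haz.le, hzb.le⟩
  · left
    have habove : ∀ z, ∃ b ∈ I, z < b := fun z => by
      obtain ⟨t, ⟨htI, -⟩, hgt⟩ :=
        ((hhi y₀ hy₀).and (htop.eventually_gt_atTop (max |m| |z|))).exists
      refine ⟨g t, htI, ?_⟩
      by_contra hzle
      have hm : m < g t := hIm htI
      have : |g t| ≤ max |m| |z| := abs_le_max_abs_abs hm.le (not_lt.1 hzle)
      linarith
    ext z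
    constructor
    · intro hz
      exact hlt z hz
    · intro hz
      obtain ⟨a, haI, haz⟩ := hbelow z hz
      obtain ⟨b, hbI, hzb⟩ := habove z
      exact hI.out haI hbI ⟨haz.le, hzb.le⟩

/-- **Registered stub `stub_intervalImage`** (E3, pure real analysis) of the line's skeleton. A
continuous strictly monotone function on an open interval `C` bounded below, with values in
`{P' > 0}` and one-sided end limits each a root of `P'` or infinite in absolute value, maps `C` onto
`(u, ∞)` or `(u, v)` with `u < v` roots of `P'`. [folklore] -/
theorem stub_intervalImage : ∀ (A' B' : ℤ) (φ : ℝ → ℝ) (C : Set ℝ) (p : ℝ),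
    (C = Ioi p ∨ ∃ q : ℝ, p < q ∧ C = Ioo p q) →
    ContinuousOn φ C → (StrictMonoOn φ C ∨ StrictAntiOn φ C) →
    φ '' C ⊆ {y : ℝ | 0 < y ^ 3 + (A' : ℝ) * y + (B' : ℝ)} →
    ((∃ ℓ : ℝ, ℓ ^ 3 + (A' : ℝ) * ℓ + (B' : ℝ) = 0 ∧ Tendsto φ (𝓝[>] p) (𝓝 ℓ)) ∨
      Tendsto (fun x => |φ x|) (𝓝[>] p) atTop) →
    (∀ q : ℝ, C = Ioo p q →
      (∃ ℓ : ℝ, ℓ ^ 3 + (A' : ℝ) * ℓ + (B' : ℝ) = 0 ∧ Tendsto φ (𝓝[<] q) (𝓝 ℓ)) ∨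
        Tendsto (fun x => |φ x|) (𝓝[<] q) atTop) →
    (C = Ioi p →
      (∃ ℓ : ℝ, ℓ ^ 3 + (A' : ℝ) * ℓ + (B' : ℝ) = 0 ∧ Tendsto φ atTop (𝓝 ℓ)) ∨
        Tendsto (fun x => |φ x|) atTop atTop) →
    ∃ u : ℝ, u ^ 3 + (A' : ℝ) * u + (B' : ℝ) = 0 ∧
      (φ '' C = Ioi u ∨
        ∃ v : ℝ, v ^ 3 + (A' : ℝ) * v + (B' : ℝ) = 0 ∧ u < v ∧ φ '' C = Ioo u v) := by
  intro A' B' φ C p hC hcont hmono hsub hleft hright hinf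
  -- generalities about the image
  set I := φ '' C with hIdef
  have hIm : I ⊆ Ioi (-(1 + |(A' : ℝ)| + |(B' : ℝ)|)) := fun y hy =>
    intervalImage_lower_bound A' B' (hsub hy)
  have hCpre : IsPreconnected C := by
    rcases hC with rfl | ⟨q, _, rfl⟩
    · exact isPreconnected_Ioi
    · exact isPreconnected_Ioo
  have hIord : I.OrdConnected := isPreconnected_iff_ordConnected.1 (hCpre.image φ hcont)
  have hpC : ∀ x ∈ C, p < x := fun x hx => by
    rcases hC with rfl | ⟨q, _, rfl⟩
    · exact hx
    · exact hx.1
  have hCne : C.Nonempty := by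
    rcases hC with rfl | ⟨q, hpq, rfl⟩
    · exact ⟨p + 1, by simp⟩
    · exact ⟨(p + q) / 2, by constructor <;> linarith⟩
  have hIne : I.Nonempty := hCne.image φ
  -- the left end filter `𝓝[>] p` enters `C` below any point of `C`
  have hCleft : ∀ x ∈ C, ∀ᶠ t in 𝓝[>] p, t ∈ C ∧ t < x := fun x hx => by
    have hpx : p < x := hpC x hx
    have hsubC : Ioo p x ⊆ C := by
      rcases hC with rfl | ⟨q, _, rfl⟩
      · exact fun t ht => ht.1
      · exact fun t ht => ⟨ht.1, ht.2.trans hx.2⟩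
    filter_upwards [Ioo_mem_nhdsGT hpx] with t ht
    exact ⟨hsubC ht, ht.2⟩
  rcases hC with rfl | ⟨q, hpq, rfl⟩
  · -- unbounded cell `(p, ∞)`: right end filter `atTop`
    have hCright : ∀ x ∈ Ioi p, ∀ᶠ t in atTop, t ∈ Ioi p ∧ x < t := fun x hx => by
      filter_upwards [eventually_gt_atTop x] with t ht
      exact ⟨lt_trans hx ht, ht⟩
    have hinf' := hinf rfl
    rcases hmono with hm | hm
    · refine intervalImage_core A' B' φ I _ (𝓝[>] p) atTop hIord hIne hIm ?_ ?_ hleft hinf'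
      · rintro _ ⟨x, hx, rfl⟩
        exact (hCleft x hx).mono fun t ht => ⟨mem_image_of_mem φ ht.1, hm ht.1 hx ht.2⟩
      · rintro _ ⟨x, hx, rfl⟩
        exact (hCright x hx).mono fun t ht => ⟨mem_image_of_mem φ ht.1, hm hx ht.1 ht.2⟩
    · refine intervalImage_core A' B' φ I _ atTop (𝓝[>] p) hIord hIne hIm ?_ ?_ hinf' hleft
      · rintro _ ⟨x, hx, rfl⟩
        exact (hCright x hx).mono fun t ht => ⟨mem_image_of_mem φ ht.1, hm hx ht.1 ht.2⟩
      · rintro _ ⟨x, hx, rfl⟩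
        exact (hCleft x hx).mono fun t ht => ⟨mem_image_of_mem φ ht.1, hm ht.1 hx ht.2⟩
  · -- bounded cell `(p, q)`: right end filter `𝓝[<] q`
    have hCright : ∀ x ∈ Ioo p q, ∀ᶠ t in 𝓝[<] q, t ∈ Ioo p q ∧ x < t := fun x hx => by
      filter_upwards [Ioo_mem_nhdsLT hx.2] with t ht
      exact ⟨⟨hx.1.trans ht.1, ht.2⟩, ht.1⟩
    have hright' := hright q rfl
    rcases hmono with hm | hm
    · refine intervalImage_core A' B' φ I _ (𝓝[>] p) (𝓝[<] q) hIord hIne hIm ?_ ?_ hleft hright'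
      · rintro _ ⟨x, hx, rfl⟩
        exact (hCleft x hx).mono fun t ht => ⟨mem_image_of_mem φ ht.1, hm ht.1 hx ht.2⟩
      · rintro _ ⟨x, hx, rfl⟩
        exact (hCright x hx).mono fun t ht => ⟨mem_image_of_mem φ ht.1, hm hx ht.1 ht.2⟩
    · refine intervalImage_core A' B' φ I _ (𝓝[<] q) (𝓝[>] p) hIord hIne hIm ?_ ?_ hright' hleft
      · rintro _ ⟨x, hx, rfl⟩
        exact (hCright x hx).mono fun t ht => ⟨mem_image_of_mem φ ht.1, hm hx ht.1 ht.2⟩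
      · rintro _ ⟨x, hx, rfl⟩
        exact (hCleft x hx).mono fun t ht => ⟨mem_image_of_mem φ ht.1, hm ht.1 hx ht.2⟩

end Summit.KontsevichZagierPeriods.IsogenyCertificates.XMapPeriodTransferCells

end
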